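/-
Copyright: the b2b-balaban T⁴-continuum CRUX team, row NE7b OWNER lineage `t4-ne7b-p1` (gen 126). Project licence.
-/
import Summits.QuantumFields.BalabanUV.T4Continuum.Spine.NE7b.SupZdPerturbedFormCoercive

/-!
# THE FLUCTUATION COVARIANCE IS `ℓ²`-BOUNDED BY THE INVERSE FLOOR: on `ℤ^d`, for the `H + K` column with `γ_K = min(2,a) − λ − εK_γ > 0`,
# every fluctuation part `w_f = C_Kf` of a bounded square-summable source `f` ((221)'s displays) satisfies
# `γ_K²·Σ′(C_Kf)² ≤ Σ′f²` and `γ_K·⟨f, C_Kf⟩ ≤ Σ′f²` — `‖C_K‖_{ℓ²→ℓ²} ≤ γ_K⁻¹` and `0 ≤ ⟨f, C_Kf⟩ ≤ γ_K⁻¹‖f‖₂²`: (257)'s floor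
# `γ_KΣ′w_f² ≤ ⟨f, w_f⟩` and the Cauchy–Schwarz inequality on `ℤ^d` (finite sums, then the limit along all finite sets); the `ℓ²`
# companion of (253)'s sup bound and (257)'s positivity (row NE7b, node U5c; (257) BY NAME; [folklore])

Cell `pub-balaban`, sub-cell `t4`, spine estimate NE7b (`T4WeightBudget.RelWeightBound`; the cell's OWN estimate — NOT PRINTED in
[Bałaban 1983–89], NOT PROVED).  Crux-route work under `Spine/NE7b/` by the row OWNER (`t4-ne7b-p1` gen 126, file (265)) under FREEZE
(0)'s crux-prover clause; NOTHING of Bałaban's is named as a Lean object, valued or asserted; no `T4Continuum/Support` leaf typed; no `def`,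
no notation (the fluctuation part and its coarse remainder are ANY data with (221)'s displays); zero `sorry`.  Imports (BY NAME): the OWNER's
(257) `…SupZdPerturbedFormCoercive` (`perturbed_covariance_floor`); Mathlib's `Finset.sum_mul_sq_le_sq_mul_sq` (Cauchy–Schwarz on finite
sets), `Summable.sum_le_tsum`, `le_of_tendsto'`.

WHY (located).  (257) gave the LOWER form bound of the covariance pairing (positivity with the gain `γ_K‖C_Kf‖₂²`); the renormalisation
step also needs the covariance SMALL in operator norm — on `ℓ^∞` that is (253) (`‖C_K‖ ≤` explicit), on `ℓ²` it is the inverse floor: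
`γ_K‖w‖₂² ≤ ⟨f, w⟩ ≤ ‖f‖₂‖w‖₂` gives `‖w‖₂ ≤ γ_K⁻¹‖f‖₂` and then `⟨f, w⟩ ≤ γ_K⁻¹‖f‖₂²`.  The only missing tool is Cauchy–Schwarz for
absolutely convergent series on `ℤ^d`, proved here from the finite-set inequality and the limit along the filter of finite sets.

WHAT IS PROVED ([folklore]):
* §1 **`tsum_mul_sq_le`** (`w², f², wf` summable on ANY index type ⟹ `(Σ′wf)² ≤ (Σ′w²)(Σ′f²)`).
* §2 THE END **`perturbed_covariance_l2`** (for ANY `w_f, c_f` with (221)'s displays, `f` bounded with `Σ′f² < ∞`, and `λ + εK_γ ≤ min(2,a)`: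
  `(Σ′w_ff)² ≤ (Σ′w_f²)(Σ′f²)`, `γ_K²Σ′w_f² ≤ Σ′f²`, `γ_KΣ′w_ff ≤ Σ′f²`).
* §3 toy.

HONEST (what this is NOT).  An `ℓ²` form bound for profile fluctuation parts; no `ℓ²` OPERATOR is packaged (density ∕ extension not
done); constants as displayed; scalar skeleton ((A3), NC-NE7b-α UNRULED); nothing of the torus; nothing of the covariant propagators of
[B4]–[B6]; nothing of Bałaban's asserted.  BY-NAME EFFECT ON THE WALL: NONE.  NE7b NOT PRINTED ∕ NOT PROVED; spine PROVED 0∕9; rung (B)+1 —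
the programme's measures remain FINITE-torus statements; NOT the mass gap, NOT Clay.  HONEST DEPENDENCY: continuum YM on T⁴ ⇐ BetaPertH ∧
nine spine estimates (0∕9 proved); BetaPertH ⇐ (D1) ∧ (D4) ∧ CAP+tail; G-an2-4 gates asym, D1 and NE2∕3∕4.
-/

set_option autoImplicit false

noncomputable section

namespace Summit.QuantumFields.BalabanUV.T4Continuum.NE7b.SupZdPerturbedCovarianceL2

open Real Filter Topology
open Literature.MathematicalPhysics.QuantumFieldTheory.Balaban1983to89
open B6QGQLower276 (X e blk B)
open SupZdPerturbedFormCoercive (perturbed_covariance_floor)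

variable {d : ℕ}

/-! ## §1. Cauchy–Schwarz for absolutely convergent series -/

/-- **CAUCHY–SCHWARZ ON AN INFINITE INDEX SET**: `w², f², wf` summable ⟹ `(Σ′wf)² ≤ (Σ′w²)(Σ′f²)` — the finite-set inequality on every finite
set, partial sums of nonnegative families below the series, and the limit of `|Σ_swf|` along all finite sets. [folklore] -/
theorem tsum_mul_sq_le {ι : Type*} (w f : ι → ℝ) (hw : Summable fun i => w i ^ 2) (hf : Summable fun i => f i ^ 2)
    (hwf : Summable fun i => w i * f i) :
    (∑' i, w i * f i) ^ 2 ≤ (∑' i, w i ^ 2) * ∑' i, f i ^ 2 := by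
  classical
  have hA : 0 ≤ ∑' i, w i ^ 2 := tsum_nonneg fun i => sq_nonneg _
  have hB : 0 ≤ ∑' i, f i ^ 2 := tsum_nonneg fun i => sq_nonneg _
  -- on every finite set
  have hfin : ∀ s : Finset ι, |∑ i ∈ s, w i * f i| ≤ Real.sqrt ((∑' i, w i ^ 2) * ∑' i, f i ^ 2) := by
    intro s
    have h1 : (∑ i ∈ s, w i * f i) ^ 2 ≤ (∑ i ∈ s, w i ^ 2) * ∑ i ∈ s, f i ^ 2 := Finset.sum_mul_sq_le_sq_mul_sq s w f
    have h2 : (∑ i ∈ s, w i ^ 2) * ∑ i ∈ s, f i ^ 2 ≤ (∑' i, w i ^ 2) * ∑' i, f i ^ 2 :=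
      mul_le_mul (hw.sum_le_tsum s fun i _ => sq_nonneg _) (hf.sum_le_tsum s fun i _ => sq_nonneg _)
        (Finset.sum_nonneg fun i _ => sq_nonneg _) hA
    rw [← Real.sqrt_sq_eq_abs]
    exact Real.sqrt_le_sqrt (h1.trans h2)
  -- the limit along all finite sets
  have hlim : Tendsto (fun s : Finset ι => |∑ i ∈ s, w i * f i|) atTop (𝓝 |∑' i, w i * f i|) := hwf.hasSum.abs
  have hle : |∑' i, w i * f i| ≤ Real.sqrt ((∑' i, w i ^ 2) * ∑' i, f i ^ 2) := le_of_tendsto' hlim hfin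
  calc (∑' i, w i * f i) ^ 2 = |∑' i, w i * f i| ^ 2 := (sq_abs _).symm
    _ ≤ Real.sqrt ((∑' i, w i ^ 2) * ∑' i, f i ^ 2) ^ 2 := pow_le_pow_left₀ (abs_nonneg _) hle 2
    _ = (∑' i, w i ^ 2) * ∑' i, f i ^ 2 := Real.sq_sqrt (mul_nonneg hA hB)

/-! ## §2. THE END: the covariance is `ℓ²`-bounded by `γ_K⁻¹` -/

/-- **HEADLINE — `γ_K²‖C_Kf‖₂² ≤ ‖f‖₂²` AND `γ_K⟨f, C_Kf⟩ ≤ ‖f‖₂²`.**  For every mesh `n`, coupling `a`, bounded potential `V ≥ −λ`, kernel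
`|K(p,q)| ≤ εe^{−γ|p−q|₁}` with `λ + εK_γ ≤ min(2,a)`, a bounded square-summable source `f`, and ANY `w_f` (block profile), `c_f` (coarse profile)
with `Q′w_f = 0`, `(H_V + K)w_f = f − c_f∘blk` ((221)'s displays of `C_Kf`): with `γ_K = min(2,a) − λ − εK_γ`,
`(Σ′w_ff)² ≤ (Σ′w_f²)(Σ′f²)`, `γ_K²Σ′w_f² ≤ Σ′f²`, and `γ_KΣ′w_ff ≤ Σ′f²` — (257)'s floor and §1. [folklore] -/
theorem perturbed_covariance_l2 (n : ℕ) (a : ℝ) {lam BV ε γ μ ν Af Cf Bf : ℝ} (hμ : 0 < μ) (hν : 0 < ν) (hνμ : ν ≤ μ)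
    (hε : 0 ≤ ε) (hγ : 0 < γ) (hsmall : lam + ε * (2 * (1 - exp (-γ))⁻¹) ^ d ≤ min 2 a)
    (V : X d → ℝ) (hV : ∀ p, -lam ≤ V p) (hVb : ∀ p, |V p| ≤ BV)
    (K : X d → X d → ℝ) (hK : ∀ p q, |K p q| ≤ ε * exp (-(γ * ∑ i, (((p i - q i).natAbs : ℕ) : ℝ))))
    (bf : X d) (f wf cf : X d → ℝ) (hfB : ∀ p, |f p| ≤ Bf) (hf2 : Summable fun p => f p ^ 2)
    (hwf : ∀ p, |wf p| ≤ Af * exp (-(μ * ∑ i, (((blk n p i - bf i).natAbs : ℕ) : ℝ))))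
    (hcf : ∀ b, |cf b| ≤ Cf * exp (-(ν * ∑ i, (((b i - bf i).natAbs : ℕ) : ℝ))))
    (hQf : ∀ b, (((n : ℝ) + 1) ^ d)⁻¹ * ∑ q ∈ B n b, wf q = 0)
    (hHf : ∀ p, ((n : ℝ) + 1) ^ 2 * ∑ ν', (2 * wf p - wf (p + e ν') - wf (p - e ν'))
      + a / ((n : ℝ) + 1) ^ d * ∑ q ∈ B n (blk n p), wf q + V p * wf p + ∑' q : X d, K p q * wf q = f p - cf (blk n p)) :
    (∑' p, wf p * f p) ^ 2 ≤ (∑' p, wf p ^ 2) * ∑' p, f p ^ 2 ∧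
    (min 2 a - lam - ε * (2 * (1 - exp (-γ))⁻¹) ^ d) ^ 2 * ∑' p, wf p ^ 2 ≤ ∑' p, f p ^ 2 ∧
    (min 2 a - lam - ε * (2 * (1 - exp (-γ))⁻¹) ^ d) * ∑' p, wf p * f p ≤ ∑' p, f p ^ 2 := by
  obtain ⟨hs, hsq, hfloor⟩ :=
    perturbed_covariance_floor n a hμ hν hνμ hε hγ V hV hVb K hK bf f wf cf hfB hwf hcf hQf hHf
  have hCS := tsum_mul_sq_le wf f hsq hf2 hs
  obtain ⟨g, hg⟩ : ∃ g : ℝ, g = min 2 a - lam - ε * (2 * (1 - exp (-γ))⁻¹) ^ d := ⟨_, rfl⟩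
  obtain ⟨W, hWd⟩ : ∃ W : ℝ, W = ∑' p, wf p ^ 2 := ⟨_, rfl⟩
  obtain ⟨F, hFd⟩ : ∃ F : ℝ, F = ∑' p, f p ^ 2 := ⟨_, rfl⟩
  obtain ⟨P, hPd⟩ : ∃ P : ℝ, P = ∑' p, wf p * f p := ⟨_, rfl⟩
  rw [← hg, ← hWd, ← hPd] at hfloor
  rw [← hWd, ← hFd, ← hPd] at hCS
  rw [← hg, ← hWd, ← hFd, ← hPd]
  have hg0 : 0 ≤ g := by rw [hg]; linarith
  have hW : 0 ≤ W := by rw [hWd]; exact tsum_nonneg fun p => sq_nonneg _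
  have hF : 0 ≤ F := by rw [hFd]; exact tsum_nonneg fun p => sq_nonneg _
  have hP : 0 ≤ P := (mul_nonneg hg0 hW).trans hfloor
  refine ⟨hCS, ?_, ?_⟩
  · -- `(gW)² ≤ P² ≤ WF` ⟹ `g²W ≤ F`
    have h1 : (g * W) ^ 2 ≤ W * F := (pow_le_pow_left₀ (mul_nonneg hg0 hW) hfloor 2).trans hCS
    by_cases hW0 : W = 0
    · rw [hW0, mul_zero]; exact hF
    · have hWpos : 0 < W := lt_of_le_of_ne hW (Ne.symm hW0)
      have h2 : g ^ 2 * W * W ≤ F * W := by nlinarith [h1]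
      exact le_of_mul_le_mul_right h2 hWpos
  · -- `gP² ≤ gWF ≤ PF` ⟹ `gP ≤ F`
    by_cases hP0 : P = 0
    · rw [hP0, mul_zero]; exact hF
    · have hPpos : 0 < P := lt_of_le_of_ne hP (Ne.symm hP0)
      have h1 : g * P ^ 2 ≤ P * F := by
        calc g * P ^ 2 ≤ g * (W * F) := mul_le_mul_of_nonneg_left hCS hg0
          _ = (g * W) * F := by ring
          _ ≤ P * F := mul_le_mul_of_nonneg_right hfloor hF
      have h2 : g * P * P ≤ F * P := by nlinarith [h1]
      exact le_of_mul_le_mul_right h2 hPpos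

/-! ## §3. Toy -/

/-- Toy: Cauchy–Schwarz on `ℕ` for two finitely supported sequences (everything zero). -/
example : (∑' i : ℕ, (fun _ => (0 : ℝ)) i * (fun _ => (0 : ℝ)) i) ^ 2
    ≤ (∑' i : ℕ, (fun _ => (0 : ℝ)) i ^ 2) * ∑' i : ℕ, (fun _ => (0 : ℝ)) i ^ 2 :=
  tsum_mul_sq_le (fun _ => 0) (fun _ => 0) (by simp) (by simp) (by simp)

end Summit.QuantumFields.BalabanUV.T4Continuum.NE7b.SupZdPerturbedCovarianceL2
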